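import Mathlib
import Literature.Probability.RandomPlanarGeometry.PlanarDomains

/-!
# Gate transfer, topology 1: Jordan loops on the frontier of a convex body; the short-arc lemma

Support file for the stub `stub_gateTransfer` (the gate transfer
`GateDecomposition → RenewalAccumulation → CarvedToSLE → HexTight → FullIdentification`) of the
line `bridge-gate-renewal` for the crux
`Summit.CriticalPhenomena.SAWScalingLimit.Theses.SAWDefectDecoherence.ObservableToSLER`
(item `stmt-CriticalPhenomena-14005`).

* `exists_loop_frontier` — the frontier of a bounded convex planar body with nonempty interior is
  a Jordan loop (continuous, `1`-periodic, injective on a period) through any prescribed point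
  (Mathlib's gauge homeomorphism onto the unit ball);
* `exists_component_arc` — the connected component of a point of such a loop inside an open set
  missing two distinct points of the loop is an open arc `θ '' (-α, β)`, `α + β < 1`, with both
  ends outside the open set;
* `exists_param_close_of_boundary_close`, `exists_short_arc` (registered sub-goal
  `stub_shortArc`) — the short-arc lemma for the boundary loop of a Jordan domain: two boundary
  points that are close in the plane cut off an arc that stays uniformly close to its start
  (uniform continuity of the loop and of its inverse; Pommerenke, *Boundary Behaviour of
  Conformal Maps* (1992), §2.2).  Elementary; tagged [folklore].
-/

noncomputable section

open scoped BigOperators Topology NNReal ENNReal Classical BoundedContinuousFunction unitInterval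
open Filter Set MeasureTheory Metric

namespace Summit.CriticalPhenomena.SAWScalingLimit.Theorems.ObservableToSLER.BridgeGate

section Loops

/-- **The frontier of a bounded convex planar body with nonempty interior is a Jordan loop
through any of its points**: a continuous `1`-periodic parametrisation, injective on a period,
starting at the prescribed point (from Mathlib's gauge homeomorphism onto the unit ball). -/
theorem exists_loop_frontier {K : Set ℂ} (hKc : Convex ℝ K) (hKi : (interior K).Nonempty)
    (hKb : Bornology.IsBounded K) {g : ℂ} (hg : g ∈ frontier K) :
    ∃ θ : ℝ → ℂ, Continuous θ ∧ Function.Periodic θ 1 ∧ InjOn θ (Ico 0 1) ∧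
      range θ = frontier K ∧ θ 0 = g := by
  obtain ⟨h, -, -, h3⟩ := exists_homeomorph_image_interior_closure_frontier_eq_unitBall hKc hKi hKb
  set w : ℂ := h g with hw
  have hw1 : ‖w‖ = 1 := by
    have : w ∈ sphere (0 : ℂ) 1 := h3 ▸ mem_image_of_mem h hg
    simpa using this
  have hw0 : w ≠ 0 := fun h0 => by simp [h0] at hw1
  set e : ℝ → ℂ := fun u => Complex.exp (2 * Real.pi * Complex.I * u) with he
  have hec : Continuous e := by simp only [he]; fun_prop
  have hep : Function.Periodic e 1 := fun u => by
    simp only [he]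
    push_cast
    rw [mul_add, mul_one, Complex.exp_add, Complex.exp_two_pi_mul_I, mul_one]
  have he1 : ∀ u, ‖e u‖ = 1 := fun u => by
    simp only [he]
    rw [show (2 * Real.pi * Complex.I * u : ℂ) = ((2 * Real.pi * u : ℝ) : ℂ) * Complex.I by
      push_cast; ring]
    exact Complex.norm_exp_ofReal_mul_I _
  refine ⟨fun u => h.symm (w * e u), h.symm.continuous.comp (continuous_const.mul hec),
    fun u => by simp only [hep u], ?_, ?_, ?_⟩
  · -- injective on a period
    intro u hu v hv huv
    have h1 : w * e u = w * e v := h.symm.injective huv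
    have h2 : e u = e v := mul_left_cancel₀ hw0 h1
    simp only [he] at h2
    obtain ⟨n, hn⟩ := Complex.exp_eq_exp_iff_exists_int.1 h2
    have hn' : (u : ℂ) = v + n := by
      have h2pi : (2 * Real.pi * Complex.I : ℂ) ≠ 0 := by
        simp [Real.pi_ne_zero, Complex.I_ne_zero]
      have := hn
      rw [show (n : ℂ) * (2 * Real.pi * Complex.I) = 2 * Real.pi * Complex.I * n by ring,
        ← mul_add] at this
      exact mul_left_cancel₀ h2pi this
    have hn'' : u = v + n := by exact_mod_cast congrArg Complex.re hn'
    have : (n : ℝ) = 0 := by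
      have h3 : |(n : ℝ)| < 1 := by rw [abs_lt]; constructor <;> linarith [hu.1, hu.2, hv.1, hv.2]
      have h4 : |n| < 1 := by exact_mod_cast h3
      have : n = 0 := Int.abs_lt_one_iff.1 h4
      simp [this]
    linarith
  · -- range
    have hsph : range (fun u => w * e u) = sphere (0 : ℂ) 1 := by
      ext z
      simp only [mem_range, mem_sphere_iff_norm, sub_zero]
      constructor
      · rintro ⟨u, rfl⟩
        rw [norm_mul, hw1, he1, one_mul]
      · intro hz
        refine ⟨Complex.arg (w⁻¹ * z) / (2 * Real.pi), ?_⟩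
        have hwz : ‖w⁻¹ * z‖ = 1 := by rw [norm_mul, norm_inv, hw1, hz]; simp
        have := Complex.norm_mul_exp_arg_mul_I (w⁻¹ * z)
        rw [hwz, Complex.ofReal_one, one_mul] at this
        simp only [he]
        rw [show (2 * Real.pi * Complex.I * ((Complex.arg (w⁻¹ * z) / (2 * Real.pi) : ℝ) : ℂ)) =
          Complex.arg (w⁻¹ * z) * Complex.I by
            push_cast; field_simp, this, mul_inv_cancel_left₀ hw0]
    show range (h.symm ∘ fun u => w * e u) = frontier K
    rw [Set.range_comp h.symm, hsph, ← h3]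
    exact h.toEquiv.symm_image_image _
  · simp [he, hw]

variable {θ : ℝ → ℂ}

/-- A `1`-periodic map factors through the fractional part. -/
theorem periodic_fract (hθp : Function.Periodic θ 1) (u : ℝ) : θ (Int.fract u) = θ u := by
  rw [Int.fract, show u - (⌊u⌋ : ℝ) = u - (⌊u⌋ : ℤ) * (1 : ℝ) by ring]
  exact hθp.sub_int_mul_eq ⌊u⌋

/-- A `1`-periodic loop injective on `[0, 1)` identifies exactly the points differing by an
integer. -/
theorem eq_add_int_of_periodic (hθp : Function.Periodic θ 1) (hθi : InjOn θ (Ico 0 1)) {u v : ℝ}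
    (h : θ u = θ v) : ∃ k : ℤ, u - v = k := by
  have hfr : Int.fract u = Int.fract v :=
    hθi ⟨Int.fract_nonneg u, Int.fract_lt_one u⟩ ⟨Int.fract_nonneg v, Int.fract_lt_one v⟩
      (by rw [periodic_fract hθp, periodic_fract hθp, h])
  exact Int.fract_eq_fract.1 hfr

/-- A `1`-periodic loop injective on `[0, 1)` is injective on every half-open window of length
one. -/
theorem injOn_Ico_of_periodic (hθp : Function.Periodic θ 1) (hθi : InjOn θ (Ico 0 1)) (s : ℝ) :
    InjOn θ (Ico s (s + 1)) := by
  intro u hu u' hu' h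
  obtain ⟨k, hk⟩ := eq_add_int_of_periodic hθp hθi h
  have hlt : |u - u'| < 1 := by
    rw [abs_lt]; constructor <;> linarith [hu.1, hu.2, hu'.1, hu'.2]
  rw [hk] at hlt
  have hz0 : k = 0 := by
    have : |k| < 1 := by exact_mod_cast hlt
    exact Int.abs_lt_one_iff.1 this
  rw [hz0] at hk
  simpa [sub_eq_zero] using hk

/-- **The component arc of a loop inside an open set.**  Let `θ` be a `1`-periodic loop,
injective on a period, `A` an open set containing `θ 0`, and suppose two DISTINCT points of the
loop lie outside `A`.  Then there are `α, β > 0` with `α + β < 1` such that `θ` maps `(-α, β)`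
into `A`, `θ (-α) ∉ A`, `θ β ∉ A`, and the connected component of `θ 0` in `range θ ∩ A` is the
open arc `θ '' (-α, β)`. -/
theorem exists_component_arc (hθc : Continuous θ) (hθp : Function.Periodic θ 1)
    (hθi : InjOn θ (Ico 0 1)) {A : Set ℂ} (hA : IsOpen A) (h0 : θ 0 ∈ A) {u₁ u₂ : ℝ}
    (h₁ : θ u₁ ∉ A) (h₂ : θ u₂ ∉ A) (hne : θ u₁ ≠ θ u₂) :
    ∃ α β : ℝ, 0 < α ∧ 0 < β ∧ α + β < 1 ∧ (∀ u ∈ Ioo (-α) β, θ u ∈ A) ∧ θ (-α) ∉ A ∧ θ β ∉ A ∧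
      connectedComponentIn (range θ ∩ A) (θ 0) = θ '' Ioo (-α) β := by
  -- reduce to `0 < v₁ < v₂ < 1`
  obtain ⟨v₁, v₂, hv₁, hv₁₂, hv₂, hv₁A, hv₂A⟩ : ∃ v₁ v₂ : ℝ, 0 < v₁ ∧ v₁ < v₂ ∧ v₂ < 1 ∧
      θ v₁ ∉ A ∧ θ v₂ ∉ A := by
    have hf₁ : θ (Int.fract u₁) ∉ A := by rwa [periodic_fract hθp]
    have hf₂ : θ (Int.fract u₂) ∉ A := by rwa [periodic_fract hθp]
    have hp₁ : 0 < Int.fract u₁ := (Int.fract_nonneg u₁).lt_of_ne (by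
      rintro h; rw [← h] at hf₁; exact hf₁ h0)
    have hp₂ : 0 < Int.fract u₂ := (Int.fract_nonneg u₂).lt_of_ne (by
      rintro h; rw [← h] at hf₂; exact hf₂ h0)
    have hne' : Int.fract u₁ ≠ Int.fract u₂ := by
      intro h; apply hne; rw [← periodic_fract hθp u₁, ← periodic_fract hθp u₂, h]
    rcases lt_or_gt_of_ne hne' with h | h
    · exact ⟨_, _, hp₁, h, Int.fract_lt_one u₂, hf₁, hf₂⟩
    · exact ⟨_, _, hp₂, h, Int.fract_lt_one u₁, hf₂, hf₁⟩
  -- forward and backward first exit times from `A`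
  set F : Set ℝ := {t | 0 ≤ t ∧ θ t ∉ A} with hF
  set B : Set ℝ := {t | 0 ≤ t ∧ θ (-t) ∉ A} with hB
  have hFc : IsClosed F := (isClosed_Ici).inter ((hA.preimage hθc).isClosed_compl)
  have hBc : IsClosed B :=
    (isClosed_Ici).inter ((hA.preimage (hθc.comp continuous_neg)).isClosed_compl)
  have hFne : F.Nonempty := ⟨v₁, hv₁.le, hv₁A⟩
  have hBne : B.Nonempty := ⟨1 - v₂, by linarith, by
    rw [show -(1 - v₂) = v₂ - 1 by ring, show θ (v₂ - 1) = θ v₂ from by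
      have := hθp (v₂ - 1); rw [sub_add_cancel] at this; exact this.symm]; exact hv₂A⟩
  have hFb : BddBelow F := ⟨0, fun t ht => ht.1⟩
  have hBb : BddBelow B := ⟨0, fun t ht => ht.1⟩
  set β := sInf F with hβ
  set α := sInf B with hα
  have hβF : β ∈ F := hFc.csInf_mem hFne hFb
  have hαB : α ∈ B := hBc.csInf_mem hBne hBb
  have hβv : β ≤ v₁ := csInf_le hFb ⟨hv₁.le, hv₁A⟩
  have hv₂' : θ (-(1 - v₂)) ∉ A := by
    rw [show -(1 - v₂) = v₂ - 1 by ring, show θ (v₂ - 1) = θ v₂ from by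
      have := hθp (v₂ - 1); rw [sub_add_cancel] at this; exact this.symm]
    exact hv₂A
  have hαv : α ≤ 1 - v₂ := csInf_le hBb ⟨by linarith, hv₂'⟩
  have hβ0 : 0 < β := hβF.1.lt_of_ne (by rintro h; rw [← h] at hβF; exact hβF.2 h0)
  have hα0 : 0 < α := hαB.1.lt_of_ne (by rintro h; rw [← h] at hαB; exact hαB.2 (by simpa using h0))
  have hfor : ∀ t, 0 ≤ t → t < β → θ t ∈ A := fun t ht htβ => by
    by_contra hcon; exact absurd (csInf_le hFb ⟨ht, hcon⟩) (not_le.2 htβ)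
  have hback : ∀ t, 0 ≤ t → t < α → θ (-t) ∈ A := fun t ht htα => by
    by_contra hcon; exact absurd (csInf_le hBb ⟨ht, hcon⟩) (not_le.2 htα)
  have hIoo : ∀ u ∈ Ioo (-α) β, θ u ∈ A := by
    intro u hu
    rcases le_or_gt 0 u with h | h
    · exact hfor u h hu.2
    · have := hback (-u) (by linarith) (by linarith [hu.1]); rwa [neg_neg] at this
  refine ⟨α, β, hα0, hβ0, by linarith, hIoo, hαB.2, hβF.2, ?_⟩
  -- the component
  apply Subset.antisymm
  · -- the two closed arcs
    set E₁ : Set ℂ := θ '' Icc (-α) β with hE₁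
    set E₂ : Set ℂ := θ '' Icc β (1 - α) with hE₂
    have hE₁c : IsClosed E₁ := (isCompact_Icc.image hθc).isClosed
    have hE₂c : IsClosed E₂ := (isCompact_Icc.image hθc).isClosed
    have hcov : range θ ⊆ E₁ ∪ E₂ := by
      rintro _ ⟨u, rfl⟩
      obtain ⟨u', hu', huu'⟩ := hθp.exists_mem_Ico one_pos u (-α)
      rw [huu']
      rcases le_or_gt u' β with h | h
      · exact Or.inl ⟨u', ⟨hu'.1, h⟩, rfl⟩
      · exact Or.inr ⟨u', ⟨h.le, by linarith [hu'.2]⟩, rfl⟩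
    have hinter : E₁ ∩ E₂ ⊆ {θ (-α), θ β} := by
      rintro z ⟨⟨u, hu, rfl⟩, ⟨u', hu', huu'⟩⟩
      rcases hu'.2.lt_or_eq with hlt | heq
      · have : u' = u := injOn_Ico_of_periodic hθp hθi (-α) ⟨by linarith [hu'.1], by linarith⟩
          ⟨hu.1, by linarith [hu.2]⟩ huu'
        have hub : u = β := le_antisymm hu.2 (this ▸ hu'.1)
        exact Or.inr (by rw [hub]; rfl)
      · left
        rw [← huu', heq, show (1 - α) = -α + 1 by ring, hθp]
    intro z hz
    have hCsub : connectedComponentIn (range θ ∩ A) (θ 0) ⊆ range θ ∩ A :=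
      connectedComponentIn_subset _ _
    have hCpre : IsPreconnected (connectedComponentIn (range θ ∩ A) (θ 0)) :=
      isPreconnected_connectedComponentIn
    have h0mem : θ 0 ∈ connectedComponentIn (range θ ∩ A) (θ 0) :=
      mem_connectedComponentIn ⟨⟨0, rfl⟩, h0⟩
    have h0E₁ : θ 0 ∈ E₁ := ⟨0, ⟨by linarith, hβ0.le⟩, rfl⟩
    -- the component does not meet `E₂`
    have hE₂empty : ¬ (connectedComponentIn (range θ ∩ A) (θ 0) ∩ E₂).Nonempty := by
      intro hne₂
      obtain ⟨y, hyC, hyE⟩ := isPreconnected_closed_iff.1 hCpre E₁ E₂ hE₁c hE₂c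
        (fun y hy => hcov (hCsub hy).1) ⟨θ 0, h0mem, h0E₁⟩ hne₂
      have hyA : y ∈ A := (hCsub hyC).2
      rcases hinter hyE with rfl | rfl
      · exact hαB.2 hyA
      · exact hβF.2 hyA
    have hzE₁ : z ∈ E₁ := by
      rcases hcov (hCsub hz).1 with h | h
      · exact h
      · exact absurd ⟨z, hz, h⟩ hE₂empty
    obtain ⟨u, hu, rfl⟩ := hzE₁
    have hzA : θ u ∈ A := (hCsub hz).2
    refine ⟨u, ⟨hu.1.lt_of_ne ?_, hu.2.lt_of_ne ?_⟩, rfl⟩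
    · rintro h; rw [← h] at hzA; exact hαB.2 hzA
    · rintro h; rw [h] at hzA; exact hβF.2 hzA
  · exact ((isPreconnected_Ioo).image θ hθc.continuousOn).subset_connectedComponentIn
      ⟨0, ⟨by linarith, hβ0⟩, rfl⟩ (by
        rintro _ ⟨u, hu, rfl⟩; exact ⟨⟨u, rfl⟩, hIoo u hu⟩)

end Loops

end Summit.CriticalPhenomena.SAWScalingLimit.Theorems.ObservableToSLER.BridgeGate

namespace Summit.CriticalPhenomena.SAWScalingLimit.Theorems.ObservableToSLER.BridgeGate

open Literature.Probability.RandomPlanarGeometry (JordanDomain)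

section ShortArc

variable (D : JordanDomain)

/-- **Inverse modulus of the boundary loop**: boundary points that are close in the plane have
close parameters modulo `1`. -/
theorem exists_param_close_of_boundary_close {κ : ℝ} (hκ : 0 < κ) :
    ∃ lam > (0 : ℝ), ∀ s ∈ Icc (0 : ℝ) 1, ∀ t ∈ Icc (0 : ℝ) 2,
      dist (D.boundary s) (D.boundary t) < lam → ∃ k : ℤ, |s - t - k| < κ := by
  by_contra hcon
  push Not at hcon
  choose s hs t ht hdist hfar using fun n : ℕ => hcon (1 / ((n : ℝ) + 1)) Nat.one_div_pos_of_nat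
  have hcomp : IsCompact (Icc (0 : ℝ) 1 ×ˢ Icc (0 : ℝ) 2) := isCompact_Icc.prod isCompact_Icc
  obtain ⟨⟨s₀, t₀⟩, -, φ, hφ, hlim⟩ :=
    hcomp.tendsto_subseq (x := fun n => (s n, t n)) fun n => ⟨hs n, ht n⟩
  have hs' : Tendsto (fun n => s (φ n)) atTop (𝓝 s₀) := (continuous_fst.tendsto _).comp hlim
  have ht' : Tendsto (fun n => t (φ n)) atTop (𝓝 t₀) := (continuous_snd.tendsto _).comp hlim
  -- the limit parameters have the same boundary point
  have hd : Tendsto (fun n => dist (D.boundary (s (φ n))) (D.boundary (t (φ n)))) atTop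
      (𝓝 (dist (D.boundary s₀) (D.boundary t₀))) :=
    ((D.continuous_boundary.tendsto _).comp hs').dist ((D.continuous_boundary.tendsto _).comp ht')
  have hd0 : Tendsto (fun n => dist (D.boundary (s (φ n))) (D.boundary (t (φ n)))) atTop (𝓝 0) := by
    refine squeeze_zero (fun n => dist_nonneg) (fun n => (hdist (φ n)).le) ?_
    exact tendsto_one_div_add_atTop_nhds_zero_nat.comp hφ.tendsto_atTop
  have heq : D.boundary s₀ = D.boundary t₀ := dist_eq_zero.1 (tendsto_nhds_unique hd hd0)
  obtain ⟨k, hk⟩ := eq_add_int_of_periodic D.periodic_boundary D.injOn_boundary heq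
  -- then the parameters are eventually `κ`-close modulo `k`
  have hconv : Tendsto (fun n => |s (φ n) - t (φ n) - k|) atTop (𝓝 |s₀ - t₀ - k|) :=
    ((hs'.sub ht').sub tendsto_const_nhds).abs
  rw [hk, sub_self, abs_zero] at hconv
  obtain ⟨n, hn⟩ := (hconv.eventually (gt_mem_nhds hκ)).exists
  exact absurd hn (not_lt.2 (hfar (φ n) k))

/-- **The short-arc lemma**: for every `η > 0` there is `λ > 0` such that two boundary points of
the Jordan domain at distance `< λ` cut the boundary curve into two arcs one of which stays
`η`-close to its starting point. -/
theorem exists_short_arc {η : ℝ} (hη : 0 < η) :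
    ∃ lam > (0 : ℝ), ∀ s t : ℝ, s < t → t < s + 1 → dist (D.boundary s) (D.boundary t) < lam →
      (∀ u ∈ Icc s t, dist (D.boundary u) (D.boundary s) < η) ∨
      (∀ u ∈ Icc t (s + 1), dist (D.boundary u) (D.boundary s) < η) := by
  -- uniform continuity of the boundary loop on `[-1, 3]`
  obtain ⟨κ, hκ, hκc⟩ := Metric.uniformContinuousOn_iff.1
    (isCompact_Icc.uniformContinuousOn_of_continuous D.continuous_boundary.continuousOn
      (s := Icc (-1 : ℝ) 3)) η hη
  set κ' := min κ (1 / 2) with hκ'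
  have hκ'0 : 0 < κ' := lt_min hκ (by norm_num)
  have hκ'κ : κ' ≤ κ := min_le_left _ _
  have hκ'h : κ' ≤ 1 / 2 := min_le_right _ _
  obtain ⟨lam, hlam, hclose⟩ := exists_param_close_of_boundary_close D hκ'0
  refine ⟨lam, hlam, fun s t hst hts hdist => ?_⟩
  -- reduce to `s' = fract s ∈ [0, 1)`, `t' = t - ⌊s⌋ ∈ (s', s' + 1)`
  set m : ℤ := ⌊s⌋ with hm
  set s' : ℝ := s - m with hs'
  set t' : ℝ := t - m with ht'
  have hshift : ∀ u : ℝ, D.boundary (u - m) = D.boundary u := fun u => by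
    rw [show u - (m : ℝ) = u - (m : ℤ) * (1 : ℝ) by ring]
    exact D.periodic_boundary.sub_int_mul_eq m
  have hs'0 : 0 ≤ s' := by rw [hs', hm]; linarith [Int.floor_le s]
  have hs'1 : s' < 1 := by rw [hs', hm]; linarith [Int.lt_floor_add_one s]
  have hds : D.boundary s' = D.boundary s := hshift s
  have hdt : D.boundary t' = D.boundary t := hshift t
  obtain ⟨k, hk⟩ := hclose s' ⟨hs'0, hs'1.le⟩ t' ⟨by linarith, by linarith⟩ (by rwa [hds, hdt])
  have hst' : s' - t' = s - t := by rw [hs', ht']; ring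
  rw [hst', abs_lt] at hk
  have hk1 : k < 1 := by
    have : (k : ℝ) < 1 := by linarith
    exact_mod_cast this
  have hk2 : -2 < k := by
    have : (-2 : ℝ) < k := by linarith
    exact_mod_cast this
  have hk' : k = 0 ∨ k = -1 := by omega
  rcases hk' with rfl | rfl
  · -- the arc `[s, t]` is short
    left
    intro u hu
    simp only [Int.cast_zero, sub_zero] at hk
    have h := hκc (u - m) ⟨by linarith [hu.1], by linarith [hu.2]⟩ s' ⟨by linarith, by linarith⟩
      (by rw [Real.dist_eq, hs', abs_lt]; constructor <;> linarith [hu.1, hu.2])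
    rwa [hshift, hds] at h
  · -- the arc `[t, s + 1]` is short
    right
    intro u hu
    simp only [Int.cast_neg, Int.cast_one, sub_neg_eq_add] at hk
    have h := hκc (u - m) ⟨by linarith [hu.1], by linarith [hu.2]⟩ (s' + 1) ⟨by linarith, by linarith⟩
      (by rw [Real.dist_eq, hs', abs_lt]; constructor <;> linarith [hu.1, hu.2])
    rw [hshift, show s' + 1 = (s + 1) - m by rw [hs']; ring, hshift, D.periodic_boundary] at h
    exact h

end ShortArc

end Summit.CriticalPhenomena.SAWScalingLimit.Theorems.ObservableToSLER.BridgeGate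

namespace Summit.CriticalPhenomena.SAWScalingLimit.Theorems.ObservableToSLER.BridgeGate

open Literature.Probability.RandomPlanarGeometry (JordanDomain)

/-- **Registered sub-goal `stub_shortArc`** (the short-arc lemma, self-contained form of `exists_short_arc`). -/
theorem stub_shortArc : ∀ (D : Literature.Probability.RandomPlanarGeometry.JordanDomain) (η : ℝ), 0 < η → ∃ lam > (0 : ℝ), ∀ s t : ℝ, s < t → t < s + 1 → dist (D.boundary s) (D.boundary t) < lam → (∀ u ∈ Set.Icc s t, dist (D.boundary u) (D.boundary s) < η) ∨ (∀ u ∈ Set.Icc t (s + 1), dist (D.boundary u) (D.boundary s) < η) :=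
  fun D _ hη => exists_short_arc D hη

end Summit.CriticalPhenomena.SAWScalingLimit.Theorems.ObservableToSLER.BridgeGate

end
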